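import Literature.NumberTheory.Rogawski1990.LocalNormFibreNonsplit                    -- ★ p840359: `IsLocalNormPair.charpoly_eq`, `charpoly_endoEmbLocal`
import Literature.NumberTheory.Rogawski1990.FinExplicitTransferFactorConjRight         -- ★ `isLocalNormPair_conj_right`
import Literature.NumberTheory.Rogawski1990.RegularOrbitalIntegralLocallyConstantCM    -- ★ p03: `isOpen_setOf_isRegularElt_local_of_nonsplit` (the regular locus is open at a non-split place)
import Literature.NumberTheory.Rogawski1990.LocalTransferGlueCM                        -- ★ `totallyDisconnectedSpace_localRing`, ★ `IsLocSmooth.indicator`, `tsupport_indicator_subset_…`, CM instances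
import Literature.LinearAlgebra.Matrix.RegularSemisimpleConjClassClosed                 -- ★ `continuous_charpoly_coeff`
import HarnessLib

/-!
# The clopen characteristic-polynomial cut-off: transfer for regular-supported test functions gives transfer NEAR every `G`-regular `γ_H` for
# ALL test functions (Rogawski 1990, §4.3 (4.3.1), §4.9 Prop. 4.9.1 (a); Langlands–Shelstad 1990, Thm. 2.3.A in the regular case)

Topic `NumberTheory/Rogawski1990`; namespace `Literature.NumberTheory.Rogawski1990`.  THEOREMS ONLY (no definition, no instance, no notation, no named fact,
no `sorry`; Mathlib-only footing; count-neutral for the books).  Cell `pub/hodgecm-mathlib` (D-0151), crux H413 = stmt-HodgeConjecture-24833, F0∕P3a road «D-N6-ns»: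
the discharge of `stub_N6nsRegLocal` of A-p12 (g18)'s floor-2 line candidate «N6nsGerm» (ED. 1.1) FROM the floor-1 target (T1) «N6-ns-reg» (F0P2-p02 (g8)'s
junction `LocalTransferChartJunctionCM`, ED. 2 head), HYPOTHESIS-DRIVEN: the (T1) statement enters as the binder `hT1` (any transfer factor `T`, any orbital
measure families `mH`, `mG`), so this file lands independently of the junction and the closer-side term is a one-liner.  Brick (o1′) of F0P3a-p08 (g13)
(LEAD F0P3a-plan (g9) T8-31 (3)).  HONEST LABEL: HC_CM is proved only modulo the printed citations until rung 0 closes; this file proves no letter.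

THE MATHEMATICS.  `G′_v = U(H′)(L⁺_v)`, `H_v = U(Φ₂)(L⁺_v) × U(Φ₁)(L⁺_v)`, `v` non-split, `E_v = Π_{w∣v} L_w`.  Given `φ ∈ C_c^∞(G′_v)` and a `G`-regular `εH ∈ H_v`:
`K := tsupport φ` is compact, the non-regular locus of `G′_v` is CLOSED (★ `isOpen_setOf_isRegularElt_local_of_nonsplit`), so the set `C′ ⊂ E_v⁴` of coefficient vectors
of the characteristic polynomials of the NON-regular points of `K` is compact (★ `continuous_charpoly_coeff`); it misses `c₀ := coeff(charpoly ι_v(εH))` (a point of `K`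
with those coefficients would have the separable characteristic polynomial of `ι_v(εH)`).  `E_v⁴` is locally compact, Hausdorff and totally disconnected (★
`totallyDisconnectedSpace_localRing`), so there is a CLOPEN `W` with `c₀ ∈ W ⊆ (C′)ᶜ` (Mathlib `loc_compact_Haus_tot_disc_of_zero_dim`).  Then
`U′ := {γ ∈ G′_v | coeff(charpoly γ) ∈ W}` is clopen and SATURATED under equality of characteristic polynomials, and `U′ ∩ K` consists of regular elements; hence
`φ₁ := 1_{U′}·φ ∈ C_c^∞(G′_v)` (★ `IsLocSmooth.indicator`) with `tsupport φ₁ ⊆ {regular}`, and (T1) gives `φ^H ∈ C_c^∞(H_v)` with `Φ^st(γ_H, φ^H) = R_{φ₁}(γ_H)` at every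
`G`-regular `γ_H`.  On `V := {γ_H | coeff(charpoly ι_v(γ_H)) ∈ W}`, an open neighbourhood of `εH` (★ `continuous_endoEmbLocal`), every class `[γ]` with `Δ(γ_H, γ) ≠ 0`
matches `γ_H` (★ `TransferFactorData.eq_zero_of_not_rel`), so `charpoly γ′ = charpoly ι_v(γ_H)` for EVERY conjugate `γ′` of `γ` (★ `isLocalNormPair_conj_right`, ★
`IsLocalNormPair.charpoly_eq`): the whole class lies in `U′`, `φ₁ = φ` on it, and `Φ([γ], φ₁) = Φ([γ], φ)` (an orbital integral only sees the values on the class).  So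
`R_φ(γ_H) = R_{φ₁}(γ_H) = Φ^st(γ_H, φ^H)` on `V` — print's «(4.9.1) holds for all `G`-regular `γ` near `γ_H`», with no additivity, no partition of unity and no
matching-existence used.

* §1 (generic) `classOrbitalIntegral_congr_of_forall_conj` (`Φ([γ], F) = Φ([γ], F′)` when `F = F′` on the class), `charpoly_eq_of_forall_coeff_eq` (a `3 × 3` characteristic
  polynomial is determined by its coefficients of degree `< 4`).
* §2 (CM, non-split `v`) `exists_isClopen_charpolySaturated_regular_nhds` (the clopen saturated `U′` with `U′ ∩ tsupport φ ⊆ {regular}` and the matching neighbourhood `V`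
  of `εH`), **`exists_nhds_stableOrbitalIntegralRel_eq_of_regularSupportTransfer`** (= `stub_N6nsRegLocal`'s body for ANY `T`, `mH`, `mG`, from the (T1) binder).

## References
* [Rogawski1990] J. D. Rogawski, *Automorphic Representations of Unitary Groups in Three Variables*, Ann. of Math. Stud. 123 (1990): §4.3 (4.3.1) p. 43; §4.9
  Prop. 4.9.1 (a) pp. 54–55 («(4.9.1) holds for all `G`-regular `γ`»); §3.1 p. 19.
* [LanglandsShelstad1990Descent] R. P. Langlands, D. Shelstad, *Descent for transfer factors*, The Grothendieck Festschrift II (1990): Thm. 2.3.A (locality of transfer; the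
  regular case is the trivial one).
* [HarishChandra1970] Harish-Chandra (notes by G. van Dijk), *Harmonic Analysis on Reductive p-adic Groups*, LNM 162 (1970): Part I §3 (the regular set is open; orbital
  integrals as class functions).
-/

set_option autoImplicit false

noncomputable section

open NumberField IsDedekindDomain Matrix Polynomial Topology Filter Set
open scoped MatrixGroups

namespace Literature.NumberTheory.Rogawski1990

open Literature.NumberTheory.Automorphic Literature.NumberTheory.Automorphic.UnitaryGroup
open Literature.LinearAlgebra.Matrix (continuous_charpoly_coeff)
open Literature.MeasureTheory.Group (descConj descConj_mk)

/-! ## §1 Generic bookkeeping -/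

section Generic

/-- **An orbital integral only sees the values of the test function on the class**: if `F(x γ_c x⁻¹) = F′(x γ_c x⁻¹)` for every `x`, then `Φ([γ_c], F) = Φ([γ_c], F′)`
(the orbital integrands `descConj` coincide pointwise on `G ⧸ Z(γ_c)`). [cite: Rogawski1990, §4.9 p. 54] [cite: HarishChandra1970, Part I §3] -/
theorem classOrbitalIntegral_congr_of_forall_conj {G : Type*} [Group G] [∀ γ : G, MeasurableSpace (G ⧸ Subgroup.centralizer ({γ} : Set G))]
    {E : Type*} [NormedAddCommGroup E] [NormedSpace ℝ E] (m : OrbitalMeasureFamily G) {F F' : G → E} (c : ConjClasses G)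
    (h : ∀ x : G, F (x * Quotient.out c * x⁻¹) = F' (x * Quotient.out c * x⁻¹)) :
    classOrbitalIntegral m F c = classOrbitalIntegral m F' c := by
  rw [classOrbitalIntegral_eq, classOrbitalIntegral_eq, orbitalIntegral_eq_integral_descConj, orbitalIntegral_eq_integral_descConj]
  refine MeasureTheory.integral_congr_ae (Filter.Eventually.of_forall fun y => ?_)
  induction y using QuotientGroup.induction_on with
  | H x => simp only [descConj_mk]; exact h x

/-- A `3 × 3` characteristic polynomial is determined by its coefficients of degree `< 4` (it is monic of degree `3`). [cite: Rogawski1990, §3.1 p. 19] -/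
theorem charpoly_eq_of_forall_coeff_eq {R : Type*} [CommRing R] [Nontrivial R] {A B : Matrix (Fin 3) (Fin 3) R}
    (h : ∀ k : Fin 4, A.charpoly.coeff k = B.charpoly.coeff k) : A.charpoly = B.charpoly := by
  refine Polynomial.ext fun k => ?_
  by_cases hk : k < 4
  · exact h ⟨k, hk⟩
  · have hA : A.charpoly.natDegree < k := by rw [Matrix.charpoly_natDegree_eq_dim, Fintype.card_fin]; omega
    have hB : B.charpoly.natDegree < k := by rw [Matrix.charpoly_natDegree_eq_dim, Fintype.card_fin]; omega
    rw [Polynomial.coeff_eq_zero_of_natDegree_lt hA, Polynomial.coeff_eq_zero_of_natDegree_lt hB]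

end Generic

/-! ## §2 The cut-off at the CM carriers, non-split `v` -/

section CM

variable (L : Type) [Field L] [NumberField L] [IsCMField L] (H' : Matrix (Fin 3) (Fin 3) L) (v : HeightOneSpectrum (𝓞 ↥(maximalRealSubfield L)))
  (w : UnitaryGroup.PlacesOver L v) (hw : IsCMField.complexConj L • w.1 = w.1)

include w hw

/-- **THE CLOPEN SATURATED REGULAR CUT-OFF.**  At a non-split `v`, for a compact `K ⊆ G′_v` and a `G`-regular `εH ∈ H_v` there are a CLOPEN `U′ ⊆ G′_v` and an OPEN
`V ∋ εH` in `H_v` such that: `U′ ∩ K` consists of regular elements; and for `γ_H ∈ V`, every `γ ∈ G′_v` matching `γ_H` (`ι_v(γ_H) ↔ γ`) lies in `U′` TOGETHER WITH ALL ITS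
CONJUGATES (`U′` is cut out by the coefficients of the characteristic polynomial: a clopen neighbourhood, in `E_v⁴`, of those of `ι_v(εH)` missing the compact set of
coefficient vectors of the non-regular points of `K`). [cite: Rogawski1990, §4.3 (4.3.1) p. 43; §3.1 p. 19] [cite: HarishChandra1970, Part I §3] -/
theorem exists_isClopen_charpolySaturated_regular_nhds {K : Set ((cmDatum L 3 H').Local v)} (hK : IsCompact K)
    (εH : (cmDatum L 2 (Matrix.of fun i j : Fin 2 => if i.val + j.val + 1 = 2 then (1 : L) else 0)).Local v ×
      (cmDatum L 1 (Matrix.of fun i j : Fin 1 => if i.val + j.val + 1 = 1 then (1 : L) else 0)).Local v)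
    (hε : IsLocalGRegular L v εH) :
    ∃ (U' : Set ((cmDatum L 3 H').Local v)) (V : Set ((cmDatum L 2 (Matrix.of fun i j : Fin 2 => if i.val + j.val + 1 = 2 then (1 : L) else 0)).Local v ×
      (cmDatum L 1 (Matrix.of fun i j : Fin 1 => if i.val + j.val + 1 = 1 then (1 : L) else 0)).Local v)),
      IsClopen U' ∧ IsOpen V ∧ εH ∈ V ∧ (∀ γ ∈ U', γ ∈ K → IsRegularElt (γ.val : GL (Fin 3) (LocalRing L v))) ∧
        ∀ γH ∈ V, ∀ γ : (cmDatum L 3 H').Local v, IsLocalNormPair L H' v γH γ → ∀ x : (cmDatum L 3 H').Local v, x * γ * x⁻¹ ∈ U' := by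
  classical
  haveI : TotallyDisconnectedSpace (LocalRing L v) := totallyDisconnectedSpace_localRing L v
  -- coefficient maps on both sides (continuous)
  obtain ⟨cG, hcG, hcGc⟩ : ∃ f : (cmDatum L 3 H').Local v → (Fin 4 → LocalRing L v),
      (∀ γ k, f γ k = (((γ.val : GL (Fin 3) (LocalRing L v)).val).charpoly).coeff k) ∧ Continuous f :=
    ⟨fun γ k => (((γ.val : GL (Fin 3) (LocalRing L v)).val).charpoly).coeff k, fun _ _ => rfl,
      continuous_pi fun k => (continuous_charpoly_coeff (k : ℕ)).comp (Units.continuous_val.comp continuous_subtype_val)⟩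
  obtain ⟨cH, hcH, hcHc⟩ : ∃ f : (cmDatum L 2 (Matrix.of fun i j : Fin 2 => if i.val + j.val + 1 = 2 then (1 : L) else 0)).Local v ×
        (cmDatum L 1 (Matrix.of fun i j : Fin 1 => if i.val + j.val + 1 = 1 then (1 : L) else 0)).Local v → (Fin 4 → LocalRing L v),
      (∀ a k, f a k = ((((endoEmbLocal L v a).val : GL (Fin 3) (LocalRing L v)).val).charpoly).coeff k) ∧ Continuous f :=
    ⟨fun a k => ((((endoEmbLocal L v a).val : GL (Fin 3) (LocalRing L v)).val).charpoly).coeff k, fun _ _ => rfl,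
      continuous_pi fun k => (continuous_charpoly_coeff (k : ℕ)).comp
        (Units.continuous_val.comp (continuous_subtype_val.comp (continuous_endoEmbLocal L v)))⟩
  -- the compact set of coefficient vectors of NON-regular points of `K`
  have hreg : IsOpen {γ : (cmDatum L 3 H').Local v | IsRegularElt (γ.val : GL (Fin 3) (LocalRing L v))} :=
    isOpen_setOf_isRegularElt_local_of_nonsplit (IsCMField.complexConj L) 3 H' (IsCMField.complexConj_ne_one L) w hw
  have hC : IsClosed (cG '' (K ∩ {γ : (cmDatum L 3 H').Local v | IsRegularElt (γ.val : GL (Fin 3) (LocalRing L v))}ᶜ)) :=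
    ((hK.inter_right hreg.isClosed_compl).image hcGc).isClosed
  -- `c₀ = coeff (charpoly ι εH)` is not one of them
  have hc₀ : cH εH ∈ (cG '' (K ∩ {γ : (cmDatum L 3 H').Local v | IsRegularElt (γ.val : GL (Fin 3) (LocalRing L v))}ᶜ))ᶜ := by
    rintro ⟨γ, ⟨-, hγnr⟩, hγeq⟩
    apply hγnr
    have heq : (((γ.val : GL (Fin 3) (LocalRing L v)).val).charpoly) = ((((endoEmbLocal L v εH).val : GL (Fin 3) (LocalRing L v)).val).charpoly) :=
      charpoly_eq_of_forall_coeff_eq fun k => by rw [← hcG γ k, ← hcH εH k, hγeq]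
    show IsRegularElt (γ.val : GL (Fin 3) (LocalRing L v))
    rw [isRegularElt_iff, heq]
    exact hε
  -- a clopen `W ∋ c₀` missing them
  obtain ⟨W, hWclopen, hc₀W, hWC⟩ :=
    (loc_compact_Haus_tot_disc_of_zero_dim (H := Fin 4 → LocalRing L v)).mem_nhds_iff.1 (hC.isOpen_compl.mem_nhds hc₀)
  refine ⟨cG ⁻¹' W, cH ⁻¹' W, hWclopen.preimage hcGc, (hWclopen.preimage hcHc).isOpen, hc₀W, fun γ hγU hγK => ?_, fun γH hγV γ hnp x => ?_⟩
  · -- points of `U′ ∩ K` are regular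
    by_contra hnr
    exact hWC hγU ⟨γ, ⟨hγK, hnr⟩, rfl⟩
  · -- the class of a matching `γ` lies in `U′`: every conjugate has the characteristic polynomial of `ι γ_H`
    have hnp' : IsLocalNormPair L H' v γH (x * γ * x⁻¹) := (isLocalNormPair_conj_right L v H' γH γ x).2 hnp
    have hco : cG (x * γ * x⁻¹) = cH γH := by
      funext k
      rw [hcG, hcH, hnp'.charpoly_eq L H' v, charpoly_endoEmbLocal]
    show cG (x * γ * x⁻¹) ∈ W
    rw [hco]
    exact hγV

variable [iH : ∀ a : (cmDatum L 2 (Matrix.of fun i j : Fin 2 => if i.val + j.val + 1 = 2 then (1 : L) else 0)).Local v ×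
      (cmDatum L 1 (Matrix.of fun i j : Fin 1 => if i.val + j.val + 1 = 1 then (1 : L) else 0)).Local v,
    MeasurableSpace (((cmDatum L 2 (Matrix.of fun i j : Fin 2 => if i.val + j.val + 1 = 2 then (1 : L) else 0)).Local v ×
      (cmDatum L 1 (Matrix.of fun i j : Fin 1 => if i.val + j.val + 1 = 1 then (1 : L) else 0)).Local v) ⧸
      Subgroup.centralizer ({a} : Set ((cmDatum L 2 (Matrix.of fun i j : Fin 2 => if i.val + j.val + 1 = 2 then (1 : L) else 0)).Local v ×
        (cmDatum L 1 (Matrix.of fun i j : Fin 1 => if i.val + j.val + 1 = 1 then (1 : L) else 0)).Local v)))]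
  [iG : ∀ γ : (cmDatum L 3 H').Local v, MeasurableSpace ((cmDatum L 3 H').Local v ⧸ Subgroup.centralizer ({γ} : Set ((cmDatum L 3 H').Local v)))]

/-- **REG-LOCAL ⟸ (T1): (4.9.1) NEAR EVERY `G`-REGULAR `γ_H`, FOR EVERY TEST FUNCTION, FROM TRANSFER OF REGULAR-SUPPORTED TEST FUNCTIONS.**  `v` non-split; `T` any
local transfer factor (supported on the matching pairs), `mH`, `mG` any orbital measure families; (T1) as the hypothesis `hT1`: every `φ₁ ∈ C_c^∞(G′_v)` supported in the
regular set has a `Δ_v`-transfer in `C_c^∞(H_v)`.  Then for every `φ ∈ C_c^∞(G′_v)` and every `G`-regular `εH ∈ H_v` there are a neighbourhood `V` of `εH` and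
`φ^H ∈ C_c^∞(H_v)` with `Φ^st(γ_H, φ^H) = Σ_{[γ]} Δ_v(γ_H, γ) Φ([γ], φ)` for all `G`-regular `γ_H ∈ V` — `φ^H :=` the transfer of the cut-off `1_{U′}·φ`
(`exists_isClopen_charpolySaturated_regular_nhds`).  This is the body of `stub_N6nsRegLocal` of the floor-2 line «N6nsGerm» at `T := Δ‴_v`.
[cite: Rogawski1990, §4.9 Prop. 4.9.1 (a) pp. 54–55; §4.3 (4.3.1) p. 43] [cite: LanglandsShelstad1990Descent, Thm. 2.3.A] -/
theorem exists_nhds_stableOrbitalIntegralRel_eq_of_regularSupportTransfer (T : LocalTransferFactor L H' v)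
    (mH : OrbitalMeasureFamily ((cmDatum L 2 (Matrix.of fun i j : Fin 2 => if i.val + j.val + 1 = 2 then (1 : L) else 0)).Local v ×
      (cmDatum L 1 (Matrix.of fun i j : Fin 1 => if i.val + j.val + 1 = 1 then (1 : L) else 0)).Local v))
    (mG : OrbitalMeasureFamily ((cmDatum L 3 H').Local v))
    (hT1 : ∀ φ : (cmDatum L 3 H').Local v → ℂ, IsLocSmooth φ →
      tsupport φ ⊆ {γ : (cmDatum L 3 H').Local v | IsRegularElt (γ.val : GL (Fin 3) (LocalRing L v))} →
      ∃ φH : (cmDatum L 2 (Matrix.of fun i j : Fin 2 => if i.val + j.val + 1 = 2 then (1 : L) else 0)).Local v ×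
          (cmDatum L 1 (Matrix.of fun i j : Fin 1 => if i.val + j.val + 1 = 1 then (1 : L) else 0)).Local v → ℂ,
        IsLocSmooth φH ∧ IsLocalDeltaTransfer L H' v T mH mG φH φ)
    (φ : (cmDatum L 3 H').Local v → ℂ) (hφ : IsLocSmooth φ)
    (εH : (cmDatum L 2 (Matrix.of fun i j : Fin 2 => if i.val + j.val + 1 = 2 then (1 : L) else 0)).Local v ×
      (cmDatum L 1 (Matrix.of fun i j : Fin 1 => if i.val + j.val + 1 = 1 then (1 : L) else 0)).Local v)
    (hε : IsLocalGRegular L v εH) :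
    ∃ V ∈ 𝓝 εH, ∃ φH : (cmDatum L 2 (Matrix.of fun i j : Fin 2 => if i.val + j.val + 1 = 2 then (1 : L) else 0)).Local v ×
        (cmDatum L 1 (Matrix.of fun i j : Fin 1 => if i.val + j.val + 1 = 1 then (1 : L) else 0)).Local v → ℂ, IsLocSmooth φH ∧
      ∀ γH ∈ V, IsLocalGRegular L v γH →
        stableOrbitalIntegralRel (IsLocalStablyConjH L v) mH φH γH =
          ∑ᶠ c : ConjClasses ((cmDatum L 3 H').Local v), T.Δ γH (Quotient.out c) * classOrbitalIntegral mG φ c := by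
  classical
  obtain ⟨U', V, hU', hV, hεV, hregU, hsat⟩ := exists_isClopen_charpolySaturated_regular_nhds L H' v w hw hφ.2.isCompact εH hε
  -- the cut-off `φ₁ := 1_{U′}·φ` is `C_c^∞` and supported in the regular set
  have hφ₁ : IsLocSmooth (U'.indicator φ) := hφ.indicator hU'
  have hφ₁supp : tsupport (U'.indicator φ) ⊆ {γ : (cmDatum L 3 H').Local v | IsRegularElt (γ.val : GL (Fin 3) (LocalRing L v))} := fun γ hγ =>
    hregU γ (tsupport_indicator_subset_of_isClosed φ hU'.isClosed hγ) (tsupport_indicator_subset_tsupport φ U' hγ)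
  obtain ⟨φH, hφH, hT⟩ := hT1 (U'.indicator φ) hφ₁ hφ₁supp
  refine ⟨V, hV.mem_nhds hεV, φH, hφH, fun γH hγV hγreg => ?_⟩
  rw [hT γH hγreg]
  refine finsum_congr fun c => ?_
  by_cases hΔ : T.Δ γH (Quotient.out c) = 0
  · rw [hΔ, zero_mul, zero_mul]
  · have hnp : IsLocalNormPair L H' v γH (Quotient.out c) := by
      by_contra h
      exact hΔ (T.eq_zero_of_not_rel _ _ h)
    rw [classOrbitalIntegral_congr_of_forall_conj mG c fun x => Set.indicator_of_mem (hsat γH hγV (Quotient.out c) hnp x) φ]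

end CM

end Literature.NumberTheory.Rogawski1990

end
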